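import Mathlib
import HarnessLib

/-!
# From Chebyshev test polynomials to compactly supported test functions

Helper for the line `FilterInvariance` of the crux `EmbeddedDrudeMourre.GreenKuboContinuation`
(stub `stub_mnTestFunctions`, one of the six pieces of the Máté–Nevai bounded-variation theorem).

Setting: `τ` is a finite measure on `ℝ` carried by `[-1, 1]`; `F n` are continuous "test densities"
with a uniform `L¹(τ)` bound, converging uniformly on every `[-1+δ, 1-δ]` to `S`; and
`∫ T_m F_n dτ → ∫_{-1}^{1} T_m w` for every Chebyshev polynomial `T_m`, `w` continuous.

Conclusion: `∫ f S dτ = ∫_{-1}^{1} f w` for every continuous `f` compactly supported inside `(-1, 1)`.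

Proof.
* `mnTest_tendsto_integral_poly`: the Chebyshev polynomials span `ℝ[X]`
  (`Polynomial.Chebyshev.chebyshevTsequence`, `Polynomial.Sequence.span`) and both sides are linear
  in the test polynomial, so `∫ P F_n dτ → ∫_{-1}^1 P w` for every polynomial `P`.
* `mnTest_tendsto_right`: Weierstrass approximation of `f` on `[-1, 1]` by polynomials, the uniform
  `L¹(τ)` bound and an `ε / 3` argument give `∫ f F_n dτ → ∫_{-1}^1 f w`.
* `mnTest_tendsto_left`: `tsupport f ⊆ [-1+δ, 1-δ]` for some `δ > 0` (`mnTest_exists_margin`), where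
  `F_n → S` uniformly; dominated convergence gives `∫ f F_n dτ → ∫ f S dτ`.
* Uniqueness of limits.
-/

noncomputable section

namespace Summit.AtomisticToContinuum.FouriersLaw.Theorems.GreenKuboContinuation.BandLimitedKrylov

open Filter Topology MeasureTheory Set Polynomial

/-! ### Integrability against a finite measure carried by `[-1, 1]` -/

/-- `τ`-almost every point lies in `[-1, 1]` if `τ` does not charge the complement of `[-1, 1]`. -/
theorem mnTest_ae_mem_Icc {τ : Measure ℝ} (hτ : τ (Set.Icc (-1 : ℝ) 1)ᶜ = 0) :
    ∀ᵐ ω ∂τ, ω ∈ Set.Icc (-1 : ℝ) 1 := by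
  filter_upwards [mem_ae_iff.2 hτ] with ω hω using hω

/-- A continuous function is integrable against a finite measure carried by `[-1, 1]`
(it is bounded on the compact interval `[-1, 1]`). -/
theorem mnTest_integrable_of_continuous {τ : Measure ℝ} [IsFiniteMeasure τ]
    (hτ : τ (Set.Icc (-1 : ℝ) 1)ᶜ = 0) {g : ℝ → ℝ} (hg : Continuous g) : Integrable g τ := by
  obtain ⟨B, hB⟩ := isCompact_Icc.exists_bound_of_continuousOn
    (hg.continuousOn (s := Set.Icc (-1 : ℝ) 1))
  exact Integrable.of_bound hg.aestronglyMeasurable B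
    ((mnTest_ae_mem_Icc hτ).mono fun ω hω => hB ω hω)

/-! ### Polynomial test functions -/

/-- **Polynomial test functions.** If `∫ T_m F_n dτ → ∫_{-1}^1 T_m w` for every Chebyshev
polynomial `T_m` (`m : ℕ`), then `∫ P F_n dτ → ∫_{-1}^1 P w` for every polynomial `P`: the `T_m` span
`ℝ[X]` (their leading coefficients `2^(m-1)` are units) and both sides are linear in the test
polynomial. -/
theorem mnTest_tendsto_integral_poly {τ : Measure ℝ} [IsFiniteMeasure τ]
    (hτ : τ (Set.Icc (-1 : ℝ) 1)ᶜ = 0) {F : ℕ → ℝ → ℝ} {w : ℝ → ℝ}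
    (hF : ∀ n, Continuous (F n)) (hw : Continuous w)
    (hcheb : ∀ m : ℕ, Tendsto (fun n : ℕ => ∫ ω, (Polynomial.Chebyshev.T ℝ m).eval ω * F n ω ∂τ)
      atTop (𝓝 (∫ x in (-1 : ℝ)..1, (Polynomial.Chebyshev.T ℝ m).eval x * w x)))
    (P : ℝ[X]) :
    Tendsto (fun n : ℕ => ∫ ω, P.eval ω * F n ω ∂τ) atTop
      (𝓝 (∫ x in (-1 : ℝ)..1, P.eval x * w x)) := by
  have hunit : ∀ i, IsUnit ((Chebyshev.chebyshevTsequence ℝ) i).leadingCoeff := fun i =>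
    isUnit_iff_ne_zero.2 (leadingCoeff_ne_zero.2 ((Chebyshev.chebyshevTsequence ℝ).ne_zero i))
  have hP : P ∈ Submodule.span ℝ (Set.range (Chebyshev.chebyshevTsequence ℝ)) := by
    rw [(Chebyshev.chebyshevTsequence ℝ).span hunit]
    exact Submodule.mem_top
  induction hP using Submodule.span_induction with
  | mem Q hQ =>
    obtain ⟨m, rfl⟩ := hQ
    exact hcheb m
  | zero =>
    simp only [eval_zero, zero_mul, integral_zero, intervalIntegral.integral_zero]
    exact tendsto_const_nhds
  | add Q R _ _ hQ hR =>
    have h1 : ∀ n, Integrable (fun ω => Q.eval ω * F n ω) τ := fun n =>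
      mnTest_integrable_of_continuous hτ (Q.continuous.fun_mul (hF n))
    have h2 : ∀ n, Integrable (fun ω => R.eval ω * F n ω) τ := fun n =>
      mnTest_integrable_of_continuous hτ (R.continuous.fun_mul (hF n))
    simp only [eval_add, add_mul]
    rw [intervalIntegral.integral_add ((Q.continuous.fun_mul hw).intervalIntegrable _ _)
      ((R.continuous.fun_mul hw).intervalIntegrable _ _)]
    exact (hQ.add hR).congr fun n => (integral_add (h1 n) (h2 n)).symm
  | smul a Q _ hQ =>
    simp only [eval_smul, smul_eq_mul, mul_assoc, integral_const_mul,
      intervalIntegral.integral_const_mul]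
    exact hQ.const_mul a

/-! ### The right limit: Weierstrass and the `L¹(τ)` bound -/

/-- **Right limit.** If `∫ P F_n dτ → ∫_{-1}^1 P w` for every polynomial `P`, the `F_n` are
continuous with `∫ |F_n| dτ ≤ C`, and `w`, `f` are continuous, then `∫ f F_n dτ → ∫_{-1}^1 f w`
(approximate `f` uniformly on `[-1, 1]` by a polynomial; `ε / 3` argument). -/
theorem mnTest_tendsto_right {τ : Measure ℝ} [IsFiniteMeasure τ]
    (hτ : τ (Set.Icc (-1 : ℝ) 1)ᶜ = 0) {F : ℕ → ℝ → ℝ} {w f : ℝ → ℝ}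
    (hF : ∀ n, Continuous (F n)) (hw : Continuous w)
    (hL1 : ∃ C : ℝ, ∀ n, ∫ ω, |F n ω| ∂τ ≤ C)
    (hpoly : ∀ P : ℝ[X], Tendsto (fun n : ℕ => ∫ ω, P.eval ω * F n ω ∂τ) atTop
      (𝓝 (∫ x in (-1 : ℝ)..1, P.eval x * w x)))
    (hf : Continuous f) :
    Tendsto (fun n : ℕ => ∫ ω, f ω * F n ω ∂τ) atTop
      (𝓝 (∫ x in (-1 : ℝ)..1, f x * w x)) := by
  obtain ⟨C₁, hC₁⟩ := hL1
  have hC0 : 0 ≤ C₁ := (integral_nonneg fun ω => abs_nonneg _).trans (hC₁ 0)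
  obtain ⟨Bw, hBw⟩ := isCompact_Icc.exists_bound_of_continuousOn
    (hw.continuousOn (s := Set.Icc (-1 : ℝ) 1))
  have hBw0 : 0 ≤ Bw := (norm_nonneg _).trans (hBw 0 (by norm_num))
  rw [Metric.tendsto_atTop]
  intro ε hε
  -- accuracy of the polynomial approximation
  have hden : 0 < C₁ + 2 * Bw + 1 := by linarith
  set η : ℝ := ε / (3 * (C₁ + 2 * Bw + 1)) with hη
  have hη0 : 0 < η := div_pos hε (by linarith)
  have hkey : η * (C₁ + 2 * Bw + 1) = ε / 3 := by
    rw [hη, div_mul_eq_mul_div, mul_div_mul_right _ _ hden.ne']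
  have hηC : η * C₁ ≤ ε / 3 := by
    rw [← hkey]
    exact mul_le_mul_of_nonneg_left (by linarith) hη0.le
  have hηw : η * Bw * 2 ≤ ε / 3 := by
    rw [← hkey, mul_assoc]
    exact mul_le_mul_of_nonneg_left (by linarith) hη0.le
  obtain ⟨P, hP⟩ := exists_polynomial_near_of_continuousOn (-1) 1 f hf.continuousOn η hη0
  obtain ⟨N, hN⟩ := Metric.tendsto_atTop.1 (hpoly P) (ε / 3) (by positivity)
  refine ⟨N, fun n hn => ?_⟩
  -- (1) `∫ f F_n dτ` is `ε/3`-close to `∫ P F_n dτ`, uniformly in `n`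
  have h1 : dist (∫ ω, f ω * F n ω ∂τ) (∫ ω, P.eval ω * F n ω ∂τ) ≤ ε / 3 := by
    rw [dist_eq_norm, ← integral_sub (mnTest_integrable_of_continuous hτ (hf.fun_mul (hF n)))
      (mnTest_integrable_of_continuous hτ (P.continuous.fun_mul (hF n)))]
    calc ‖∫ ω, (f ω * F n ω - P.eval ω * F n ω) ∂τ‖
        ≤ ∫ ω, η * |F n ω| ∂τ := by
          refine norm_integral_le_of_norm_le
            (((mnTest_integrable_of_continuous hτ (hF n)).abs).const_mul η) ?_
          filter_upwards [mnTest_ae_mem_Icc hτ] with ω hω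
          rw [Real.norm_eq_abs, ← sub_mul, abs_mul]
          refine mul_le_mul_of_nonneg_right ?_ (abs_nonneg _)
          rw [abs_sub_comm]
          exact (hP ω hω).le
      _ = η * ∫ ω, |F n ω| ∂τ := integral_const_mul _ _
      _ ≤ η * C₁ := mul_le_mul_of_nonneg_left (hC₁ n) hη0.le
      _ ≤ ε / 3 := hηC
  -- (2) `∫ P F_n dτ` is eventually `ε/3`-close to `∫_{-1}^1 P w`
  have h2 : dist (∫ ω, P.eval ω * F n ω ∂τ) (∫ x in (-1 : ℝ)..1, P.eval x * w x) < ε / 3 :=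
    hN n hn
  -- (3) `∫_{-1}^1 P w` is `ε/3`-close to `∫_{-1}^1 f w`
  have h3 : dist (∫ x in (-1 : ℝ)..1, P.eval x * w x) (∫ x in (-1 : ℝ)..1, f x * w x) ≤ ε / 3 := by
    rw [dist_eq_norm, ← intervalIntegral.integral_sub
      ((P.continuous.fun_mul hw).intervalIntegrable _ _) ((hf.fun_mul hw).intervalIntegrable _ _)]
    calc ‖∫ x in (-1 : ℝ)..1, (P.eval x * w x - f x * w x)‖
        ≤ η * Bw * |(1 : ℝ) - (-1)| := by
          refine intervalIntegral.norm_integral_le_of_norm_le_const fun x hx => ?_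
          have hx' : x ∈ Set.Icc (-1 : ℝ) 1 := by
            rw [Set.uIoc_of_le (by norm_num)] at hx
            exact Set.Ioc_subset_Icc_self hx
          rw [Real.norm_eq_abs, ← sub_mul, abs_mul]
          exact mul_le_mul (hP x hx').le (hBw x hx') (abs_nonneg _) hη0.le
      _ = η * Bw * 2 := by norm_num
      _ ≤ ε / 3 := hηw
  calc dist (∫ ω, f ω * F n ω ∂τ) (∫ x in (-1 : ℝ)..1, f x * w x)
      ≤ dist (∫ ω, f ω * F n ω ∂τ) (∫ ω, P.eval ω * F n ω ∂τ)
        + dist (∫ ω, P.eval ω * F n ω ∂τ) (∫ x in (-1 : ℝ)..1, P.eval x * w x)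
        + dist (∫ x in (-1 : ℝ)..1, P.eval x * w x) (∫ x in (-1 : ℝ)..1, f x * w x) :=
        dist_triangle4 _ _ _ _
    _ < ε / 3 + ε / 3 + ε / 3 := by linarith
    _ = ε := by ring

/-! ### The left limit: uniform convergence on the support -/

/-- A compact subset of `(-1, 1)` (here `tsupport f`) keeps a positive distance from `±1`:
`tsupport f ⊆ [-1+δ, 1-δ]` for some `δ > 0`. -/
theorem mnTest_exists_margin {f : ℝ → ℝ} (hfc : HasCompactSupport f)
    (hfK : tsupport f ⊆ Set.Ioo (-1) 1) :
    ∃ δ : ℝ, 0 < δ ∧ tsupport f ⊆ Set.Icc (-1 + δ) (1 - δ) := by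
  obtain ⟨δ, hδ, hsub⟩ := hfc.isCompact.exists_cthickening_subset_open isOpen_Ioo hfK
  refine ⟨δ, hδ, fun x hx => ?_⟩
  have hx' := hfK hx
  by_contra h
  rw [Set.mem_Icc, not_and_or, not_le, not_le] at h
  rcases h with h | h
  · have hmem : (-1 : ℝ) ∈ Metric.cthickening δ (tsupport f) :=
      Metric.mem_cthickening_of_dist_le (-1) x δ _ hx
        (by rw [Real.dist_eq, abs_le]; constructor <;> linarith [hx'.1])
    exact lt_irrefl _ (hsub hmem).1
  · have hmem : (1 : ℝ) ∈ Metric.cthickening δ (tsupport f) :=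
      Metric.mem_cthickening_of_dist_le 1 x δ _ hx
        (by rw [Real.dist_eq, abs_le]; constructor <;> linarith [hx'.2])
    exact lt_irrefl _ (hsub hmem).2

/-- **Left limit.** If the continuous `F_n` converge to `S` uniformly on every `[-1+δ, 1-δ]`
(`δ > 0`) and `f` is continuous with compact support inside `(-1, 1)`, then
`∫ f F_n dτ → ∫ f S dτ` for every finite measure `τ` (dominated convergence: on `tsupport f` the
convergence is uniform, so the `f F_n` are eventually uniformly bounded; off `tsupport f` everything
vanishes). -/
theorem mnTest_tendsto_left {τ : Measure ℝ} [IsFiniteMeasure τ] {F : ℕ → ℝ → ℝ} {S f : ℝ → ℝ}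
    (hF : ∀ n, Continuous (F n))
    (hunif : ∀ δ : ℝ, 0 < δ → TendstoUniformlyOn F S atTop (Set.Icc (-1 + δ) (1 - δ)))
    (hf : Continuous f) (hfc : HasCompactSupport f) (hfK : tsupport f ⊆ Set.Ioo (-1) 1) :
    Tendsto (fun n : ℕ => ∫ ω, f ω * F n ω ∂τ) atTop (𝓝 (∫ ω, f ω * S ω ∂τ)) := by
  obtain ⟨δ, hδ, hK⟩ := mnTest_exists_margin hfc hfK
  set K : Set ℝ := Set.Icc (-1 + δ) (1 - δ) with hKdef
  have hU : TendstoUniformlyOn F S atTop K := hunif δ hδ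
  -- bounds for `f` (everywhere) and `S` (on `K`)
  obtain ⟨Bf, hBf⟩ := hf.bounded_above_of_compact_support hfc
  have hBf0 : 0 ≤ Bf := (norm_nonneg _).trans (hBf 0)
  have hSK : ContinuousOn S K :=
    hU.continuousOn (Frequently.of_forall fun n => (hF n).continuousOn)
  obtain ⟨BS, hBS⟩ := (isCompact_Icc : IsCompact K).exists_bound_of_continuousOn hSK
  have hzero : ∀ x, x ∉ K → f x = 0 := fun x hx =>
    image_eq_zero_of_notMem_tsupport fun h => hx (hK h)
  refine tendsto_integral_filter_of_dominated_convergence (fun _ => Bf * (|BS| + 1))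
    (Eventually.of_forall fun n => (hf.fun_mul (hF n)).aestronglyMeasurable) ?_
    (integrable_const _) ?_
  · -- eventually `|f F_n| ≤ Bf (|BS| + 1)` everywhere
    filter_upwards [Metric.tendstoUniformlyOn_iff.1 hU 1 one_pos] with n hn
    refine Eventually.of_forall fun x => ?_
    show ‖f x * F n x‖ ≤ Bf * (|BS| + 1)
    by_cases hx : x ∈ K
    · have h1 : ‖F n x‖ ≤ |BS| + 1 := by
        have hd : dist (F n x) (S x) < 1 := by
          rw [dist_comm]
          exact hn x hx
        rw [dist_eq_norm] at hd
        linarith [norm_sub_norm_le (F n x) (S x), hBS x hx, le_abs_self BS]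
      rw [norm_mul]
      exact mul_le_mul (hBf x) h1 (norm_nonneg _) hBf0
    · rw [hzero x hx, zero_mul, norm_zero]
      positivity
  · -- pointwise convergence everywhere
    refine Eventually.of_forall fun x => ?_
    by_cases hx : x ∈ K
    · exact (hU.tendsto_at hx).const_mul (f x)
    · simp only [hzero x hx, zero_mul]
      exact tendsto_const_nhds

/-! ### The stub -/

/-- **`stub_mnTestFunctions` — from Chebyshev test polynomials to compactly supported test
functions.** Let `τ` be a finite measure carried by `[-1, 1]`, `F_n` continuous functions with
`sup_n ∫ |F_n| dτ < ∞`, converging uniformly on every `[-1+δ, 1-δ]` to `S`, and such that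
`∫ T_m F_n dτ → ∫_{-1}^{1} T_m w` for every Chebyshev polynomial `T_m` (`w` continuous). Then
`∫ f S dτ = ∫_{-1}^{1} f w` for every continuous `f` with compact support inside `(-1, 1)`
(Chebyshev polynomials span `ℝ[X]`; Weierstrass on `[-1, 1]`; an `ε/3` argument with the `L¹(τ)` bound;
on `tsupport f` the convergence `F_n → S` is uniform; uniqueness of limits). [folklore] -/
theorem stub_mnTestFunctions :
    ∀ (τ : Measure ℝ), IsFiniteMeasure τ → τ (Set.Icc (-1 : ℝ) 1)ᶜ = 0 →
      ∀ (F : ℕ → ℝ → ℝ) (S w : ℝ → ℝ),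
        (∀ n, Continuous (F n)) → Continuous w →
        (∃ C : ℝ, ∀ n, ∫ ω, |F n ω| ∂τ ≤ C) →
        (∀ δ : ℝ, 0 < δ → TendstoUniformlyOn F S atTop (Set.Icc (-1 + δ) (1 - δ))) →
        (∀ m : ℕ, Tendsto (fun n : ℕ => ∫ ω, (Polynomial.Chebyshev.T ℝ m).eval ω * F n ω ∂τ)
          atTop (𝓝 (∫ x in (-1 : ℝ)..1, (Polynomial.Chebyshev.T ℝ m).eval x * w x))) →
        ∀ f : ℝ → ℝ, Continuous f → HasCompactSupport f → tsupport f ⊆ Set.Ioo (-1) 1 →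
          ∫ ω, f ω * S ω ∂τ = ∫ x in (-1 : ℝ)..1, f x * w x := by
  intro τ hfin hτ F S w hF hw hL1 hunif hcheb f hf hfc hfK
  haveI := hfin
  exact tendsto_nhds_unique (mnTest_tendsto_left hF hunif hf hfc hfK)
    (mnTest_tendsto_right hτ hF hw hL1 (mnTest_tendsto_integral_poly hτ hF hw hcheb) hf)

end Summit.AtomisticToContinuum.FouriersLaw.Theorems.GreenKuboContinuation.BandLimitedKrylov

end
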